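import Summits.RiemannHypothesis.RiemannHypothesis.Theses.SignCone

/-!
# `SignCone.SignConeOscillatory` — line `dual-witness`: the KKT / extremal-function split (crux stmt-RiemannHypothesis-16302)

Seat `dual-witness` (planner, LENSES-v3 §3.18), 2026-08-17.  A TYPED TWO-PIECE DECOMPOSITION of the crux through the
EXTREMAL FUNCTION of its own linear programme (Bombieri's variational approach transplanted to the sign cone):

* `SignConeExtremalExists`  (X₁, "an extremal function with property P exists"; RH-free, provable by variational /
  LP-duality means): at every cutoff `a` the value `μ(a) = inf {Re W_ar(F) + Re F(0) : F ∈ sign cone(a), Re F(0) = 1}`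
  is ATTAINED by an `L²`-autocorrelation `f ⋆ f̃` (`supp f ⊆ [-a, a]`, `‖f‖₂ = 1`) of finite archimedean energy lying
  in the closed sign cone, and carries a KKT certificate: a nonnegative fake von Mangoldt weight `c` on the nodes
  `2 ≤ n ≤ N` (`e^{2a} ≤ N`) that is dual-feasible with slack parameter `1 - μ(a)` and complementary to the node
  values of `f ⋆ f̃`.  (Primal attainment: Bombieri 2000, *Remarks on Weil's quadratic functional I*, Thm 3 pattern —
  log-weight coercivity of the archimedean term + normal families; dual attainment: the landed cone-multiplier engine
  of `SignConeDuality` (`Theorems/SignConeSignConeDualityStubEngine.lean`) with first coordinate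
  `Re W_ar(F) + (1 - μ) Re F(0)`; complementary slackness: evaluate the dual inequality at the minimiser.)
* `SignConeExtremalNonneg`  (X₂, the positivity remainder; RH-strength): every such KKT-extremal configuration has
  `μ ≥ 0` — i.e. NO solution of the fake Euler–Lagrange / Bombieri eigen-problem
  `(2cosh(u/2) + arch kernel + (1-μ)δ₀ - Σₙ c(n) n^{-1/2}(δ_{log n} + δ_{-log n})) ⋆ f = 0 on (-a, a)`
  with nonnegative, node-complementary fake primes `c` has eigen-parameter `μ < 0`.
* `signConeOscillatory_of_extremal : SignConeExtremalExists → SignConeExtremalNonneg → SignConeOscillatory`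
  (sorry-free; the seam is `μ · Re F(0) ≤ Re W_ar(F) + Re F(0)`, `0 ≤ μ`, `0 ≤ Re F(0)`).

All statements are over Mathlib primitives (no `Literature` import: the route's CONE NOTE), with four local
abbreviations (`autocorr`, `mellinShift`, `archIntegrand`, `reWar`) that unfold DEFINITIONALLY to the binders of the
route items.  See `DUAL-NUMERICS.md` (same crux directory) for the numerics behind the choice of P and the BC2 probes.
-/

noncomputable section

-- `Summit.RiemannHypothesis.RiemannHypothesis.…` repeats a namespace component by design (D-0017 layout).
set_option linter.dupNamespace false

open scoped BigOperators ComplexConjugate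
open MeasureTheory

namespace Summit.RiemannHypothesis.RiemannHypothesis.Cruxes.SignConeOscillatory.DualWitness

/-- The autocorrelation `g ⋆ g̃`, spelled exactly as in the route items. -/
def autocorr (g : ℝ → ℂ) : ℝ → ℂ :=
  MeasureTheory.convolution g (fun u => (starRingEnd ℂ) (g (-u))) (ContinuousLinearMap.mul ℂ ℂ)
    MeasureTheory.MeasureSpace.volume

/-- The shifted Mellin–Fourier transform `M_F(s) = ∫ F(u) e^{(s - 1/2)u} du` (the binder `M` of the route items). -/
def mellinShift (F : ℝ → ℂ) (s : ℂ) : ℂ := ∫ u : ℝ, F u * Complex.exp ((s - 1 / 2) * u)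

/-- The archimedean integrand `M_F(1/2 + it) · Re ψ(1/4 + it/2)`. -/
def archIntegrand (F : ℝ → ℂ) (t : ℝ) : ℂ :=
  mellinShift F (1 / 2 + t * Complex.I) * ((Complex.digamma (1 / 4 + t / 2 * Complex.I)).re : ℂ)

/-- `Re W_ar(F)` = real part of the polar-plus-archimedean Weil form, verbatim the right-hand side of the route items. -/
def reWar (F : ℝ → ℂ) : ℝ :=
  (mellinShift F 0 + mellinShift F 1 + ((1 / (2 * Real.pi) : ℂ) * (∫ t : ℝ, archIntegrand F t)
    - F 0 * (Real.log Real.pi : ℂ))).re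

/-- The truncated fake prime sum `P_c^{(N)}(F) = Σ_{2 ≤ n ≤ N} c(n) n^{-1/2} · 2 Re F(log n)` (route normalisation of
`P_c(F) = Σ c(n) n^{-1/2}(F(log n) + F(-log n))` on hermitian `F`). -/
def fakePrimeSum (c : ℕ → ℝ) (N : ℕ) (F : ℝ → ℂ) : ℝ :=
  ∑ n ∈ Finset.Icc 2 N, c n / Real.sqrt n * (2 * (F (Real.log n)).re)

/-- The sign-cone families of the crux at cutoff `a`: finitely many smooth compactly supported `gᵢ` in `[-a, a]`. -/
def IsConeFamily (a : ℝ) (k : ℕ) (g : Fin k → ℝ → ℂ) : Prop :=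
  ∀ i, (ContDiff ℝ ((⊤ : ℕ∞) : WithTop ℕ∞) (g i) ∧ HasCompactSupport (g i)) ∧ tsupport (g i) ⊆ Set.Icc (-a) a

/-- Their autocorrelation sum `F = Σᵢ gᵢ ⋆ g̃ᵢ` (the binder `F` of the route items). -/
def coneSum (k : ℕ) (g : Fin k → ℝ → ℂ) : ℝ → ℂ := fun t => ∑ i, autocorr (g i) t

/-- **KKT-extremal configuration at cutoff `a` with value `μ`.**
(i) `μ` is a lower bound for `(Re W_ar(F) + Re F(0)) / Re F(0)` on the node-nonnegative sign cone at cutoff `a`;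
(ii) it is ATTAINED by the `L²`-autocorrelation `f ⋆ f̃` (`supp f ⊆ [-a,a]`, `Re (f⋆f̃)(0) = ‖f‖₂² = 1`,
node-nonnegative, archimedean integrand integrable — so `reWar` is the genuine value, no junk integral);
(iii) the nonnegative node weight `c` (fake von Mangoldt, nodes `2 ≤ n ≤ N`, `e^{2a} ≤ N`) is DUAL-FEASIBLE with slack
parameter `1 - μ` on every smooth test supported in `[-a, a]`;
(iv) complementary slackness: `c` annihilates the node values of `f ⋆ f̃`. -/
def IsExtremalKKT (a μ : ℝ) (N : ℕ) (c : ℕ → ℝ) (f : ℝ → ℂ) : Prop :=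
  Real.exp (2 * a) ≤ N ∧ (∀ n, 0 ≤ c n) ∧
  (∀ (k : ℕ) (g : Fin k → ℝ → ℂ), IsConeFamily a k g →
      (∀ n : ℕ, 2 ≤ n → 0 ≤ (coneSum k g (Real.log n)).re) →
      μ * (coneSum k g 0).re ≤ reWar (coneSum k g) + (coneSum k g 0).re) ∧
  (MemLp f 2 volume ∧ Function.support f ⊆ Set.Icc (-a) a ∧ (autocorr f 0).re = 1 ∧
      (∀ n : ℕ, 2 ≤ n → 0 ≤ (autocorr f (Real.log n)).re) ∧
      Integrable (archIntegrand (autocorr f)) volume ∧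
      reWar (autocorr f) + 1 = μ) ∧
  (∀ g : ℝ → ℂ, (ContDiff ℝ ((⊤ : ℕ∞) : WithTop ℕ∞) g ∧ HasCompactSupport g) → tsupport g ⊆ Set.Icc (-a) a →
      fakePrimeSum c N (autocorr g) ≤ reWar (autocorr g) + (1 - μ) * (autocorr g 0).re) ∧
  fakePrimeSum c N (autocorr f) = 0

/-- **X₁ — `SignConeExtremalExists`.**  At every cutoff the sign-cone value is attained by an `L²`-autocorrelation
carrying a KKT certificate (fake primes with slack `1 - μ`, complementary to its node values).  RH-free; provable by
variational / conic-duality means (Bombieri 2000 Thm 3 pattern + the landed `SignConeDuality` engine). -/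
def SignConeExtremalExists : Prop :=
  ∀ a : ℝ, 0 < a → ∃ μ : ℝ, ∃ N : ℕ, ∃ c : ℕ → ℝ, ∃ f : ℝ → ℂ, IsExtremalKKT a μ N c f

/-- **X₂ — `SignConeExtremalNonneg`.**  Every KKT-extremal configuration has nonnegative value: no node-complementary
nonnegative fake-prime weight admits an `L²` null-autocorrelation of negative eigen-parameter (the RH-strength
remainder; Bombieri's eigenvalue problem with fake primes). -/
def SignConeExtremalNonneg : Prop :=
  ∀ a μ : ℝ, 0 < a → ∀ (N : ℕ) (c : ℕ → ℝ) (f : ℝ → ℂ), IsExtremalKKT a μ N c f → 0 ≤ μ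

/-! ### The two registered stubs of line `dual-witness` (X₁ provable-now-ish, X₂ RH-strength) -/

/-- **Stub X₁** (`SignConeExtremalExists`): KKT-extremal configurations exist at every cutoff.  PLAN (3 lemmas):
(1) primal attainment in the closed cone `{f ⋆ f̃ : f ∈ L²(-a,a)}` (Akhiezer–Krein factorisation of nonnegative
entire functions of exponential type; Bombieri 2000 Thm 3: log-weight coercivity of the archimedean term, normal
families, no loss of mass); (2) node multipliers `c ≥ 0` with slack `1 - μ` from the landed cone-multiplier engine
`SignConeDuality.stub_engine` (first coordinate `Re W_ar(F) + (1-μ) Re F(0)`, Slater point `stub_slater`);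
(3) complementary slackness by evaluating (2) along smooth `L²`-approximants of the minimiser. -/
theorem stub_extremalExists : SignConeExtremalExists := by
  sorry

/-- **Stub X₂** (`SignConeExtremalNonneg`): no KKT-extremal configuration has negative value.  RH-strength
(X₁ ∧ X₂ → crux → RH given `ConeMagnification`); attack surface: the minimiser `f` is a NULL VECTOR of the positive
form `Q_{c,μ}(g) = Re W_ar(g⋆g̃) + (1-μ)‖g‖² - P_c(g⋆g̃)`, hence solves Bombieri's Euler–Lagrange convolution
equation on `(-a, a)` with FAKE primes `c` complementary to its own node values, and the Krein–Bochner representing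
measure of `Q_{c,μ}` (fake zeros) is atomic on the real zeros of `f̂ ∈ PW_a` (zero budget `(2a/π)·Y`). -/
theorem stub_extremalNonneg : SignConeExtremalNonneg := by
  sorry

/-- `Re (g ⋆ g̃)(0) = ∫ ‖g‖² ≥ 0` (junk-safe: a non-integrable `‖g‖²` gives `0`). -/
theorem autocorr_zero_re_nonneg (g : ℝ → ℂ) : 0 ≤ (autocorr g 0).re := by
  unfold autocorr
  rw [MeasureTheory.convolution_def]
  simp only [ContinuousLinearMap.mul_apply', zero_sub, neg_neg, Complex.mul_conj]
  rw [integral_complex_ofReal, Complex.ofReal_re]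
  exact integral_nonneg fun t => Complex.normSq_nonneg _

theorem coneSum_zero_re_nonneg (k : ℕ) (g : Fin k → ℝ → ℂ) : 0 ≤ (coneSum k g 0).re := by
  unfold coneSum
  rw [Complex.re_sum]
  exact Finset.sum_nonneg fun i _ => autocorr_zero_re_nonneg (g i)

open Summit.RiemannHypothesis.RiemannHypothesis.Theses.SignCone in
/-- **Assembly (sorry-free).** `X₁ → X₂ → SignConeOscillatory`: take the KKT-extremal configuration at cutoff `a`
(X₁), read off `0 ≤ μ` (X₂), and combine the lower bound (i) with `0 ≤ Re F(0)`; the oscillation hypothesis of the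
crux is not needed (it is idle, `SignConeOscillatory ↔ SignConeInequality`, p129083). -/
theorem signConeOscillatory_of_extremal (h₁ : SignConeExtremalExists) (h₂ : SignConeExtremalNonneg) :
    SignConeOscillatory := by
  intro a ha k g hg F hn _hosc M
  obtain ⟨μ, N, c, f, hK⟩ := h₁ a ha
  have hμ : 0 ≤ μ := h₂ a μ ha N c f hK
  have hlb : μ * (coneSum k g 0).re ≤ reWar (coneSum k g) + (coneSum k g 0).re := hK.2.2.1 k g hg hn
  have hF0 : 0 ≤ (coneSum k g 0).re := coneSum_zero_re_nonneg k g
  have hprod : 0 ≤ μ * (coneSum k g 0).re := mul_nonneg hμ hF0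
  show -(coneSum k g 0).re ≤ reWar (coneSum k g)
  linarith

open Summit.RiemannHypothesis.RiemannHypothesis.Theses.SignCone in
/-- **The crux by name** (line `dual-witness`): `SignConeOscillatory` from the two stubs.  CLOSED MODULO
`{stub_extremalExists, stub_extremalNonneg}`. -/
theorem SignConeOscillatory_of : SignConeOscillatory :=
  signConeOscillatory_of_extremal stub_extremalExists stub_extremalNonneg

end Summit.RiemannHypothesis.RiemannHypothesis.Cruxes.SignConeOscillatory.DualWitness

end
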